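import Summits.QuantumFields.YangMills.Theorems.FluctuationComparisonRegPrIntLOrganTangentFibreMeanVersionMW
import Summits.QuantumFields.YangMills.Theorems.FluctuationComparisonRegPrIntLOrganTangentAPackageDescendTo
import Summits.QuantumFields.YangMills.Theorems.FluctuationComparisonRegPrIntLOrganTangentFibreMeanSquareResponse
import Summits.QuantumFields.YangMills.Theorems.FluctuationComparisonRegPrIntLOrganTangentFibreMeanVersionUnique
import Summits.QuantumFields.YangMills.Theorems.FluctuationComparisonRegPrIntLOrganTangentGaugeConjugateProbe
import Summits.QuantumFields.YangMills.Theorems.FluctuationComparisonRegPrIntLOrganTangentSigmaVersionChartMean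
import Summits.QuantumFields.YangMills.Theorems.FluctuationComparisonRegPrIntLOrganTangentMultiWindowWeight
import Summits.QuantumFields.YangMills.Theorems.FluctuationComparisonRegPrIntLRunpairOrganFibreLawJSqEDefs
import Summits.QuantumFields.YangMills.Theorems.FluctuationComparisonRegPrIntLOrganTangentTangentHOfSpreadFibreLaw
import Literature.MathematicalPhysics.QuantumFieldTheory.Balaban1983to89.BalabanAdmissibleClassParams
import Literature.MathematicalPhysics.QuantumFieldTheory.Balaban1983to89.T4AveragingDisintegration
import Literature.MathematicalPhysics.QuantumFieldTheory.Balaban1983to89.T4CubeChartExp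
import HarnessLib

/-!
# ᴱ-EDITION (E) of ✓`…OrganTangentTangentHOfSpreadFibreLawSq` — RULING №60∕№105 «BACKGROUND WINDOWS»: block ⑤ of the inlined frame texts re-lettered (px8 g25 Φ_h),
# measurability helper re-pointed (SPEC-2); every other byte of statements∕proofs VERBATIM; width seat `ym-ust-20520-w5` g26 pen (LEAD w3 g28 №44), generator `gen_sqE.py`.
# Route `UnitScaleTilt` — crux `FluctuationComparisonRegPrIntL` (stmt-QuantumFields-20520, rung R3), PATH-B organ, sq-programme step (sq2): «THE LIN KNIT, NEAR-PAIR EDITION» —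
# `SpreadFibreLawHJsq → ⟨LINᵘ-H″⟩`, the proof text of ✓p812884 `tangentH_of_spreadFibreLawH` re-run against the NEAR-PAIR row `SpreadFibreLawHJsq` (✓`…RunpairOrganFibreLawJSqDefs`)

Cell `ym3-torus` (rung R3 = continuum `SU(2)` Yang–Mills on T³ — NOT d = 4, NOT infinite volume, NOT a mass gap, NOT Clay).  Width seat `ym-ust-20520-w4` (gen 24),
LEAD-20520 w3 g26 RULING №38 (b) ∕ №40 (A)–(sq2) («apex-sq FIRST: it is the kernel certificate of "near pairs only"»); `--kind proof --supports stmt-QuantumFields-20520 --as helper`,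
count-neutral, DEFINITION-FREE, default heartbeats, `autoImplicit false`; registry ∕ `Lines/` untouched.

WHAT THIS IS.  The LIN knit ✓p812884 (LEAD w3 g25∕g26) proves LINᵘ-H″ from the frozen hypothesis row `SpreadFibreLawH` (all-pairs law points).  w4 g24's INSTANCE TABLE
(HOME `ym-ust-20520-w4/g24/INSTANCE-TABLE-HJ-w4g24.md` 96d7f6a7) records that its proof instantiates ONLY near pairs: (JT-h) at law point `Y` (`hA … U V W Y Y`), (L1ʲ-h) at the
adjacent edges `(U,V,V,Y)` ∕ `(U,W,W,Y)`, (L2ʲ-h) on the square.  This file is THE SAME PROOF TEXT, generated from the tree bytes of ✓p812884 by the script `make_knits_sq.py`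
(HOME `…/g24/sq2/`), with exactly these edits: (i) hypothesis `SpreadFibreLawHJsq` (the near-pair edition: (JT-h) with `Xw := Y`, (L1ʲ-h) with `U₂ := V₁`, …) instead of
`SpreadFibreLawH`; (ii) the head peel reads the Jensen-superset letters and discards them; (iii) the three instantiation lines drop the arguments that named the corner
(`… U V W Y Y … hY hY …` ↦ `… U V W Y … hY …`, `… U V V Y … hV hV …` ↦ `… U V Y … hV …`, `… U W W Y … hW hW …` ↦ `… U W Y … hW …`); (iv) `fourthCorner_lawEdge` is
IMPORTED from ✓p812884 instead of re-declared.  The CONCLUSION (LINᵘ-H″, ws16 46d0024cf4aa803f, = BRICK 1 v2.2 ✓p812444's `hL`) is byte-identical.  That the kernel accepts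
it is the certificate that the LIN knit never used a far pair.

HONEST FRAMING: bookkeeping over HYPOTHESIS schemas; `SpreadFibreLawHJsq` is a hypothesis row (weaker than `SpreadFibreLawHJ`, ✓`…SpreadFibreLawHJsqOfHJ`); nothing of
Bałaban's analysis is asserted or proved; LINᵘ-H″, O1ᵘ-H v2.2, S1aᴴ, S3ᴴ, S2α′, S2β, the five registered stubs, crux 20520 and `YM3TorusSU2` are NOT proved; rung R3 = SU(2)
YM₃ on T³ at fixed lattice data — NOT d = 4, NOT infinite volume, NOT a mass gap, NOT Clay; the Yang–Mills mass gap is NOT proved.  Credit: LEAD w3 g25∕g26 (the proof).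
-/

set_option autoImplicit false

noncomputable section

namespace Summit.QuantumFields.YangMills.Theorems.OrganTangentTangentHOfSpreadFibreLawSqE

-- ᴱ: px8 g25's Φ_h names lit `iterBlockOf` (the blocks' feet) unqualified
open Literature.MathematicalPhysics.QuantumFieldTheory.Balaban1983to89.B5Eq118OneStroke (iterBlockOf)
open MeasureTheory Filter Topology Function
open scoped ENNReal NNReal BigOperators
open Literature.MathematicalPhysics.QuantumFieldTheory.Balaban1983to89 T3ContinuumYM3Torus T3NestedUnitLaws
  T3UnitLawDensityEML T4Continuum BalabanUVClass T3UnitScaleTilt T3LevelShift T3TiltDescent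
open T4CubeChartExp (expPt)
open Summit.QuantumFields.YangMills.Theorems.FluctuationComparisonRegPrIntLOrganTangentFibreMeanVersionMW
open Summit.QuantumFields.YangMills.Theorems.FluctuationComparisonRegPrIntLOrganTangentAPackageDescendTo
open Summit.QuantumFields.YangMills.Theorems.FluctuationComparisonRegPrIntLRunpairOrganFibreLaw
open Summit.QuantumFields.YangMills.Theorems.FluctuationComparisonRegPrIntLRunpairOrganFibreLawJSqE (SpreadFibreLawHJsq)
open Summit.QuantumFields.YangMills.Theorems.OrganTangentTangentHOfSpreadFibreLaw (fourthCorner_lawEdge)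
open Summit.QuantumFields.YangMills.Theorems.FluctuationComparisonRegPrIntLOrganTangentMultiWindowWeight (exists_height_multiWindowWeight)


/-- kernel: the ℓ¹ torus step distance is symmetric. [folklore] -/
private theorem tdist_comm' {P : Params} {i : ℕ} (x y : Site P i) : Site.tdist x y = Site.tdist y x := by
  unfold Site.tdist
  exact Finset.sum_congr rfl fun μ _ => min_comm _ _

/-- kernel: the four-corner re-bracketing behind ✓R2b, as a RING identity in the nine basic integrals `I a c := ∫ F_a·ŵ_c`. [folklore] -/
private theorem rebracket (IYY IVV IWW IUU IVY IWY IUY IUV IUW : ℝ) :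
    IYY - IVV - IWW + IUU = (IYY - IVY - IWY + IUY) + ((IVY - IUY) - (IVV - IUV)) + ((IWY - IUY) - (IWW - IUW))
      + (IUY - IUV - IUW + IUU) := by ring

/-- kernel: a four-term combination against one weight, as four basic integrals. [folklore] -/
private theorem integral_comb4_mul {Z : Type*} [MeasurableSpace Z] (τ : Measure Z) (a b c d w : Z → ℝ)
    (ha : Integrable (fun z => a z * w z) τ) (hb : Integrable (fun z => b z * w z) τ)
    (hc : Integrable (fun z => c z * w z) τ) (hd : Integrable (fun z => d z * w z) τ) :
    ∫ z, (a z - b z - c z + d z) * w z ∂τ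
      = (∫ z, a z * w z ∂τ) - (∫ z, b z * w z ∂τ) - (∫ z, c z * w z ∂τ) + ∫ z, d z * w z ∂τ := by
  have h1 : Integrable (fun z => a z * w z - b z * w z) τ := ha.sub hb
  have h2 : Integrable (fun z => a z * w z - b z * w z - c z * w z) τ := h1.sub hc
  have e : ∀ z, (a z - b z - c z + d z) * w z = a z * w z - b z * w z - c z * w z + d z * w z := fun z => by ring
  simp_rw [e]
  rw [integral_add h2 hd, integral_sub h1 hc, integral_sub ha hb]

/-- kernel: `|a + b + c + d| ≤ |a| + |b| + |c| + |d|`. [folklore] -/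
private theorem abs_add_four (a b c d : ℝ) : |a + b + c + d| ≤ |a| + |b| + |c| + |d| :=
  (abs_add_le _ _).trans (add_le_add ((abs_add_le _ _).trans (add_le_add (abs_add_le _ _) le_rfl)) le_rfl)

/-- ★★★ **THE LIN KNIT**: `SpreadFibreLawH → LINᵘ-H″` — the conclusion is the hypothesis text LINᵘ-H″ (LIN′ edc3b855215b4c15 with the `∃ pW … pW ≤ p₀ →` head; ws16
46d0024cf4aa803f = BRICK 1 v2.2's `hL` binder) SPELLED OUT.  Bookkeeping over hypothesis schemas (module docstring: steps (0)–(4)); nothing of Bałaban's is asserted. [folklore] -/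
theorem tangentH_of_spreadFibreLawHJsq (hF : SpreadFibreLawHJsq) :
  ∃ pW : ℝ, ∃ γ₁ : ℝ, 0 < γ₁ ∧ ∀ (F : T3Family) (γ : ℝ), 0 < γ → γ ≤ γ₁ → ∀ (b₀ p₀ : ℝ) (j₀ : ℕ) (prm : ℕ → ClassParams) (η : ℕ → ℝ) (rA : ℝ) (Bρ : ℕ → ℝ), 0 < b₀ → 0 < p₀ → pW ≤ p₀ → AdmissibleClassParams F γ b₀ p₀ prm → (∀ j, 0 ≤ η j) → Summable η → Summable (fun i => ∑' k, η (k + i)) → Tendsto (fun j => (∑' k, η (k + j)) * ((1 + 2 * ((F.L : ℝ) ^ j / γ) * (Fintype.card (Plaq (F.P j) 0) : ℝ)) * (Fintype.card (PBond (F.P j) 0) : ℝ) ^ 2)) atTop (𝓝 0) → 0 < rA → ∃ κ₀ : ℝ, 0 < κ₀ ∧ ∀ (κ : ℝ), 0 < κ → κ ≤ κ₀ → ∃ (θ r Ctr w₀ : ℝ) (εd δ : ℕ → ℝ) (j₁ : ℕ), 0 < θ ∧ 0 < r ∧ 1 ≤ Ctr ∧ 0 < w₀ ∧ (∀ j, 0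 ≤ εd j ∧ 0 ≤ δ j) ∧ Summable εd ∧ Summable δ ∧ Summable (fun i => ∑' k, δ (k + i)) ∧ Tendsto (fun j => (∑' k, δ (k + j)) * ((1 + 2 * ((F.L : ℝ) ^ j / γ) * (Fintype.card (Plaq (F.P j) 0) : ℝ)) * (Fintype.card (PBond (F.P j) 0) : ℝ) ^ 2)) atTop (𝓝 0) ∧ j₀ ≤ j₁ ∧ ∀ (ν : ℕ → (j : ℕ) → MeasureTheory.Measure (GaugeField (F.P j) 0 ↥(Matrix.specialUnitaryGroup (Fin 2) ℂ))), (∀ K, ν K K = T4GenFunBounds.gibbsMeasure (F.P K) ((F.scheme ℰp γ).β K)) → (∀ K j, j < K → ν K j = Measure.map (descend F ℰp j) (ν K (j + 1))) → ∀ (K K' : ℕ), K ≤ K' → ∀ (Ts T : ℕ), Ts < T → T ≤ K → ∀ (μ μ' : ((j : ℕ) → MeasureTheory.Measure (GaugeField (F.P j) 0 ↥(Matrix.specialUnitaryGroup (Fin 2) ℂ)))) (ρ ρ' : ((j : ℕ) → GaugeField (F.P j) 0 ↥(Matrix.specialUnitaryGroup (Fin 2) ℂ) → ℝ)), (∀ j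 : ℕ, Ts ≤ j → j ≤ T → μ j = ν K j ∧ μ' j = ν K' j) → (∀ j : ℕ, j < Ts → μ j = Measure.map (descend F ℰp j) ((μ (j + 1)).withDensity (fun U => ENNReal.ofReal ((∏ p : Plaq _ _, max 0 (min 1 ((24 / 25 * (θBal F.L γ b₀ p₀ (j + 1)) - dist1 (GaugeField.plaqHol U p)) / ((24 / 25 - 1 / 2) * (θBal F.L γ b₀ p₀ (j + 1))))))))) ∧ μ' j = Measure.map (descend F ℰp j) ((μ' (j + 1)).withDensity (fun U => ENNReal.ofReal ((∏ p : Plaq _ _, max 0 (min 1 ((24 / 25 * (θBal F.L γ b₀ p₀ (j + 1)) - dist1 (GaugeField.plaqHol U p)) / ((24 / 25 - 1 / 2) * (θBal F.L γ b₀ p₀ (j + 1)))))))))) → (∀ j : ℕ, Ts ≤ j → j < T → μ j = Measure.map (descend F ℰp j) (μ (j + 1)) ∧ μ' j = Measure.map (descend F ℰp j) (μ' (j + 1))) → (∀ j : ℕ, j ≤ T → IsFiniteMeasure (μ j) ∧ IsFiniteMeasure (μ' j)) → (∀ j : ℕ, j₀ ≤ j → j ≤ T → ((∀ U, PlaqSmall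 (θBal F.L γ b₀ p₀ j) U → 0 < ρ j U ∧ 0 < ρ' j U) ∧ μ j = (fieldMeasure _ _ _).withDensity (fun U => ENNReal.ofReal (ρ j U)) ∧ μ' j = (fieldMeasure _ _ _).withDensity (fun U => ENNReal.ofReal (ρ' j U)) ∧ (∃ (K : ℕ) (hjK : j ≤ K),
        ∃ κ : ℝ, ∃ (bg : GaugeField (F.P K) (K - j) (Matrix.specialUnitaryGroup (Fin 2) ℂ) → GaugeField (F.P K) 0 (Matrix.specialUnitaryGroup (Fin 2) ℂ))
          (nDom : ℕ) (supp : Fin nDom → Set (PBond (F.P K) 0)) (foot : Fin nDom → Finset (Site (F.P K) (K - j)))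
          (len : Fin nDom → ℝ) (wt : Fin nDom → ℝ) (act : Fin nDom → GaugeField (F.P K) 0 (Matrix.specialUnitaryGroup (Fin 2) ℂ) → ℝ)
          (cst : ℝ) (lf : GaugeField (F.P K) (K - j) (Matrix.specialUnitaryGroup (Fin 2) ℂ) → ℝ),
          (∀ V, 0 ≤ readAtLevel F hjK (fun U => Real.exp κ * ρ j U) V) ∧
          Measurable (readAtLevel F hjK (fun U => Real.exp κ * ρ j U)) ∧
          GaugeField.GaugeInvariant (readAtLevel F hjK (fun U => Real.exp κ * ρ j U)) ∧
          (∀ V, PlaqSmall (prm j).δ V →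
            IsBackground (fun i => BlockAveraging.blockAvg (P := F.P K) (j := i) ℰp) {U | PlaqSmall (prm j).δreg U} (K - j) V (bg V)) ∧
          (∀ X, (foot X).Nonempty) ∧ (∀ X b, b ∈ supp X → iterBlockOf (K - j) b.src ∈ foot X) ∧ (∀ X, 0 ≤ len X) ∧ (∀ X, 0 ≤ wt X) ∧
          (∀ X, ∀ y ∈ foot X, ∀ y' ∈ foot X, (Site.tdist y y' : ℝ) ≤ (prm j).M * (len X + 1)) ∧
          (∀ X (U U' : GaugeField (F.P K) 0 (Matrix.specialUnitaryGroup (Fin 2) ℂ)), (∀ b ∈ supp X, U b = U' b) → act X U = act X U') ∧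
          (∀ X, GaugeField.GaugeInvariant (act X)) ∧
          (∀ X V, PlaqSmall (prm j).δ V → PlaqSmall ((prm j).δ * ((F.L : ℝ)⁻¹) ^ (2 * (K - j))) (bg V) →
            |act X (bg V)| ≤ wt X * Real.exp (-((prm j).κ * len X))) ∧
          (∀ y : Site (F.P K) (K - j), ∑ X ∈ Finset.univ.filter (fun X => y ∈ foot X), wt X * Real.exp (-((prm j).κ * len X)) ≤ (prm j).Ccov) ∧
          |cst| ≤ (prm j).cE * Fintype.card (Site (F.P K) (K - j)) ∧
          (∀ V, PlaqSmall (prm j).δ V → PlaqSmall ((prm j).δ * ((F.L : ℝ)⁻¹) ^ (2 * (K - j))) (bg V) →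
            Real.exp (-((prm j).β * wilsonAction4 (bg V)) + (∑ X, act X (bg V)) + cst - (prm j).slack) ≤ readAtLevel F hjK (fun U => Real.exp κ * ρ j U) V) ∧
          (∀ V, PlaqSmall (prm j).δ V → PlaqSmall ((prm j).δ * ((F.L : ℝ)⁻¹) ^ (2 * (K - j))) (bg V) →
            readAtLevel F hjK (fun U => Real.exp κ * ρ j U) V ≤ Real.exp (-((prm j).β * wilsonAction4 (bg V)) + (∑ X, act X (bg V)) + cst + (prm j).slack) + lf V) ∧
          (∀ V, 0 ≤ lf V) ∧ (∀ V, lf V ≤ Real.exp (-(prm j).cLF) * Real.exp ((prm j).c5 * Fintype.card (Site (F.P K) (K - j)))) ∧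
          (∀ V (S : Finset (Plaq (F.P K) (K - j))), (∀ p ∈ S, (prm j).δL ≤ dist1 (GaugeField.plaqHol V p)) →
            readAtLevel F hjK (fun U => Real.exp κ * ρ j U) V ≤ Real.exp (-((prm j).cLF * S.card)) * Real.exp ((prm j).c5 * Fintype.card (Site (F.P K) (K - j))))) ∧ (∃ (K : ℕ) (hjK : j ≤ K),
        ∃ κ : ℝ, ∃ (bg : GaugeField (F.P K) (K - j) (Matrix.specialUnitaryGroup (Fin 2) ℂ) → GaugeField (F.P K) 0 (Matrix.specialUnitaryGroup (Fin 2) ℂ))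
          (nDom : ℕ) (supp : Fin nDom → Set (PBond (F.P K) 0)) (foot : Fin nDom → Finset (Site (F.P K) (K - j)))
          (len : Fin nDom → ℝ) (wt : Fin nDom → ℝ) (act : Fin nDom → GaugeField (F.P K) 0 (Matrix.specialUnitaryGroup (Fin 2) ℂ) → ℝ)
          (cst : ℝ) (lf : GaugeField (F.P K) (K - j) (Matrix.specialUnitaryGroup (Fin 2) ℂ) → ℝ),
          (∀ V, 0 ≤ readAtLevel F hjK (fun U => Real.exp κ * ρ' j U) V) ∧
          Measurable (readAtLevel F hjK (fun U => Real.exp κ * ρ' j U)) ∧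
          GaugeField.GaugeInvariant (readAtLevel F hjK (fun U => Real.exp κ * ρ' j U)) ∧
          (∀ V, PlaqSmall (prm j).δ V →
            IsBackground (fun i => BlockAveraging.blockAvg (P := F.P K) (j := i) ℰp) {U | PlaqSmall (prm j).δreg U} (K - j) V (bg V)) ∧
          (∀ X, (foot X).Nonempty) ∧ (∀ X b, b ∈ supp X → iterBlockOf (K - j) b.src ∈ foot X) ∧ (∀ X, 0 ≤ len X) ∧ (∀ X, 0 ≤ wt X) ∧
          (∀ X, ∀ y ∈ foot X, ∀ y' ∈ foot X, (Site.tdist y y' : ℝ) ≤ (prm j).M * (len X + 1)) ∧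
          (∀ X (U U' : GaugeField (F.P K) 0 (Matrix.specialUnitaryGroup (Fin 2) ℂ)), (∀ b ∈ supp X, U b = U' b) → act X U = act X U') ∧
          (∀ X, GaugeField.GaugeInvariant (act X)) ∧
          (∀ X V, PlaqSmall (prm j).δ V → PlaqSmall ((prm j).δ * ((F.L : ℝ)⁻¹) ^ (2 * (K - j))) (bg V) →
            |act X (bg V)| ≤ wt X * Real.exp (-((prm j).κ * len X))) ∧
          (∀ y : Site (F.P K) (K - j), ∑ X ∈ Finset.univ.filter (fun X => y ∈ foot X), wt X * Real.exp (-((prm j).κ * len X)) ≤ (prm j).Ccov) ∧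
          |cst| ≤ (prm j).cE * Fintype.card (Site (F.P K) (K - j)) ∧
          (∀ V, PlaqSmall (prm j).δ V → PlaqSmall ((prm j).δ * ((F.L : ℝ)⁻¹) ^ (2 * (K - j))) (bg V) →
            Real.exp (-((prm j).β * wilsonAction4 (bg V)) + (∑ X, act X (bg V)) + cst - (prm j).slack) ≤ readAtLevel F hjK (fun U => Real.exp κ * ρ' j U) V) ∧
          (∀ V, PlaqSmall (prm j).δ V → PlaqSmall ((prm j).δ * ((F.L : ℝ)⁻¹) ^ (2 * (K - j))) (bg V) →
            readAtLevel F hjK (fun U => Real.exp κ * ρ' j U) V ≤ Real.exp (-((prm j).β * wilsonAction4 (bg V)) + (∑ X, act X (bg V)) + cst + (prm j).slack) + lf V) ∧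
          (∀ V, 0 ≤ lf V) ∧ (∀ V, lf V ≤ Real.exp (-(prm j).cLF) * Real.exp ((prm j).c5 * Fintype.card (Site (F.P K) (K - j)))) ∧
          (∀ V (S : Finset (Plaq (F.P K) (K - j))), (∀ p ∈ S, (prm j).δL ≤ dist1 (GaugeField.plaqHol V p)) →
            readAtLevel F hjK (fun U => Real.exp κ * ρ' j U) V ≤ Real.exp (-((prm j).cLF * S.card)) * Real.exp ((prm j).c5 * Fintype.card (Site (F.P K) (K - j))))) ∧ μ j {U | ¬ PlaqSmall (θBal F.L γ b₀ p₀ j) U} ≤ ENNReal.ofReal (η j) ∧ μ' j {U | ¬ PlaqSmall (θBal F.L γ b₀ p₀ j) U} ≤ ENNReal.ofReal (η j) ∧ (ContinuousOn (ρ j) {U | PlaqSmall (θBal F.L γ b₀ p₀ j) U} ∧ ContinuousOn (ρ' j) {U | PlaqSmall (θBal F.L γ b₀ p₀ j) U}) ∧ ((∀ (U : GaugeField _ _ ↥(Matrix.specialUnitaryGroup (Fin 2) ℂ)), PlaqSmall (49 / 50 * θBal F.L γ b₀ p₀ j) U → ∀ (b b' : PBond _ _) (v v' : Fin 3 → ℝ),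 ‖v‖ ≤ 1 → ‖v'‖ ≤ 1 → ∃ g : ℂ × ℂ → ℂ, DifferentiableOn ℂ g (Metric.ball (0 : ℂ) (rA * (49 / 50 * θBal F.L γ b₀ p₀ j)) ×ˢ Metric.ball (0 : ℂ) (rA * (49 / 50 * θBal F.L γ b₀ p₀ j))) ∧ (∀ (s t : ℝ) (V Z : GaugeField _ _ ↥(Matrix.specialUnitaryGroup (Fin 2) ℂ)), |s| < rA * (49 / 50 * θBal F.L γ b₀ p₀ j) → |t| < rA * (49 / 50 * θBal F.L γ b₀ p₀ j) → (∀ e, e ≠ b → V e = U e) → V b = U b * expPt (s • v) → (∀ e, e ≠ b' → Z e = V e) → Z b' = V b' * expPt (t • v') → g ((s : ℂ), (t : ℂ)) = (((Real.log (ρ j Z)) : ℝ) : ℂ)) ∧ ∀ z ∈ Metric.ball (0 : ℂ) (rA * (49 / 50 * θBal F.L γ b₀ p₀ j)) ×ˢ Metric.ball (0 : ℂ) (rA * (49 / 50 * θBal F.L γ b₀ p₀ j)), ‖g z - g 0‖ ≤ (Bρ j)) ∧ (∀ (U : GaugeField _ _ ↥(Matrix.specialUnitaryGroup (Fin 2)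 ℂ)), PlaqSmall (49 / 50 * θBal F.L γ b₀ p₀ j) U → ∀ (b b' : PBond _ _) (v v' : Fin 3 → ℝ), ‖v‖ ≤ 1 → ‖v'‖ ≤ 1 → ∃ g : ℂ × ℂ → ℂ, DifferentiableOn ℂ g (Metric.ball (0 : ℂ) (rA * (49 / 50 * θBal F.L γ b₀ p₀ j)) ×ˢ Metric.ball (0 : ℂ) (rA * (49 / 50 * θBal F.L γ b₀ p₀ j))) ∧ (∀ (s t : ℝ) (V Z : GaugeField _ _ ↥(Matrix.specialUnitaryGroup (Fin 2) ℂ)), |s| < rA * (49 / 50 * θBal F.L γ b₀ p₀ j) → |t| < rA * (49 / 50 * θBal F.L γ b₀ p₀ j) → (∀ e, e ≠ b → V e = U e) → V b = U b * expPt (s • v) → (∀ e, e ≠ b' → Z e = V e) → Z b' = V b' * expPt (t • v') → g ((s : ℂ), (t : ℂ)) = (((Real.log (ρ' j Z)) : ℝ) : ℂ)) ∧ ∀ z ∈ Metric.ball (0 : ℂ) (rA * (49 / 50 * θBal F.L γ b₀ p₀ j)) ×ˢ Metric.ball (0 : ℂ) (rA * (49 / 50 * θBal F.L γ b₀ p₀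 j)), ‖g z - g 0‖ ≤ (Bρ j))))) → ∀ (w : ℝ), 0 ≤ w → w / (((F.L : ℝ) ^ Ts / γ) * θBal F.L γ b₀ p₀ Ts ^ 2) ≤ w₀ → (∃ k : PBond (F.P Ts) 0 → PBond (F.P Ts) 0 → ℝ, (∀ b b', 0 ≤ k b b') ∧ (∀ b, ∑ b', k b b' * Real.exp (κ * (b.src.tdist b'.src : ℝ)) ≤ w) ∧ (∀ (b b' : PBond _ _) (v v' : Fin 3 → ℝ) (U V W Z : GaugeField _ _ ↥(Matrix.specialUnitaryGroup (Fin 2) ℂ)), ‖v‖ ≤ (rA / 2) * (θBal F.L γ b₀ p₀ Ts / 4) → ‖v'‖ ≤ (rA / 2) * (θBal F.L γ b₀ p₀ Ts / 4) → PlaqSmall (θBal F.L γ b₀ p₀ Ts / 4) U → PlaqSmall (θBal F.L γ b₀ p₀ Ts / 4) V → PlaqSmall (θBal F.L γ b₀ p₀ Ts / 4) W → PlaqSmall (θBal F.L γ b₀ p₀ Ts / 4) Z → (∀ e, e ≠ b → V e = U e) → V b = U b * expPt v → (∀ e, e ≠ b' → W e = U e) → W b' = U b' * expPt v' → (∀ e,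 e ≠ b' → Z e = V e) → Z b' = V b' * expPt v' → |(Real.log (ρ Ts Z) - Real.log (ρ' Ts Z)) - (Real.log (ρ Ts V) - Real.log (ρ' Ts V)) - (Real.log (ρ Ts W) - Real.log (ρ' Ts W)) + (Real.log (ρ Ts U) - Real.log (ρ' Ts U))| ≤ k b b' * (‖v‖ / (θBal F.L γ b₀ p₀ Ts / 4)) * (‖v'‖ / (θBal F.L γ b₀ p₀ Ts / 4)))) → ∀ (j : ℕ), j₁ ≤ j → ∀ (hjTs : j + 1 ≤ Ts), ∀ (σ : ProbabilityTheory.Kernel (GaugeField (F.P j) 0 ↥(Matrix.specialUnitaryGroup (Fin 2) ℂ)) (GaugeField (F.P Ts) 0 ↥(Matrix.specialUnitaryGroup (Fin 2) ℂ))), ProbabilityTheory.IsMarkovKernel σ → (Measure.map (descendTo F ℰp j Ts (Nat.le_of_succ_le hjTs)) (fieldMeasure (F.P Ts) 0 ↥(Matrix.specialUnitaryGroup (Fin 2) ℂ))).bind ⇑σ = fieldMeasure (F.P Ts) 0 ↥(Matrix.specialUnitaryGroup (Fin 2) ℂ) → (∀ᵐ V ∂(Measure.map (descendTo F ℰp j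 Ts (Nat.le_of_succ_le hjTs)) (fieldMeasure (F.P Ts) 0 ↥(Matrix.specialUnitaryGroup (Fin 2) ℂ))), ∀ᵐ U ∂(σ V), descendTo F ℰp j Ts (Nat.le_of_succ_le hjTs) U = V) → ∀ (mfun : GaugeField (F.P j) 0 ↥(Matrix.specialUnitaryGroup (Fin 2) ℂ) → ℝ), ContinuousOn mfun {V | PlaqSmall (θBal F.L γ b₀ p₀ j) V} → (∀ᵐ V ∂(fieldMeasure (F.P j) 0 ↥(Matrix.specialUnitaryGroup (Fin 2) ℂ)), PlaqSmall (θBal F.L γ b₀ p₀ j) V → MeasureTheory.Integrable (fun U => (∏ i ∈ Finset.range (Ts - j), (if h : j + 1 + i ≤ Ts then (∏ p : Plaq (F.P (j + 1 + i)) 0, max 0 (min 1 ((24 / 25 * θBal F.L γ b₀ p₀ (j + 1 + i) - dist1 (GaugeField.plaqHol (descendTo F ℰp (j + 1 + i) Ts h U) p)) / ((24 / 25 - 1 / 2) * θBal F.L γ b₀ p₀ (j + 1 + i))))) else 1)) * (Real.log (ρ Ts U) - Real.log (ρ' Ts U)) * ρ' Ts U) (σ V) ∧ mfun V = (∫ U,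 (∏ i ∈ Finset.range (Ts - j), (if h : j + 1 + i ≤ Ts then (∏ p : Plaq (F.P (j + 1 + i)) 0, max 0 (min 1 ((24 / 25 * θBal F.L γ b₀ p₀ (j + 1 + i) - dist1 (GaugeField.plaqHol (descendTo F ℰp (j + 1 + i) Ts h U) p)) / ((24 / 25 - 1 / 2) * θBal F.L γ b₀ p₀ (j + 1 + i))))) else 1)) * (Real.log (ρ Ts U) - Real.log (ρ' Ts U)) * ρ' Ts U ∂(σ V)) / (∫ U, (∏ i ∈ Finset.range (Ts - j), (if h : j + 1 + i ≤ Ts then (∏ p : Plaq (F.P (j + 1 + i)) 0, max 0 (min 1 ((24 / 25 * θBal F.L γ b₀ p₀ (j + 1 + i) - dist1 (GaugeField.plaqHol (descendTo F ℰp (j + 1 + i) Ts h U) p)) / ((24 / 25 - 1 / 2) * θBal F.L γ b₀ p₀ (j + 1 + i))))) else 1)) * ρ' Ts U ∂(σ V))) → ∃ (c' : Plaq (F.P j) 0 → ℝ) (a' w' : ℝ), 0 ≤ a' ∧ 0 ≤ w' ∧ a' + θ * (w' / (((F.L : ℝ) ^ j / γ) * θBal F.L γ b₀ p₀ j ^ 2))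 ≤ (Ctr + εd (T - (Ts + 1))) * (w / (((F.L : ℝ) ^ Ts / γ) * θBal F.L γ b₀ p₀ Ts ^ 2)) + δ j ∧ (∀ p, |c' p| ≤ a') ∧ ∃ k' : PBond (F.P j) 0 → PBond (F.P j) 0 → ℝ, (∀ b b', 0 ≤ k' b b') ∧ (∀ b, ∑ b', k' b b' * Real.exp (κ * (b.src.tdist b'.src : ℝ)) ≤ w') ∧ (∀ (b b' : PBond _ _) (v v' : Fin 3 → ℝ) (U V W Z : GaugeField _ _ ↥(Matrix.specialUnitaryGroup (Fin 2) ℂ)), ‖v‖ ≤ r * (θBal F.L γ b₀ p₀ j / 4) → ‖v'‖ ≤ r * (θBal F.L γ b₀ p₀ j / 4) → PlaqSmall (θBal F.L γ b₀ p₀ j / 4) U → PlaqSmall (θBal F.L γ b₀ p₀ j / 4) V → PlaqSmall (θBal F.L γ b₀ p₀ j / 4) W → PlaqSmall (θBal F.L γ b₀ p₀ j / 4) Z → (∀ e, e ≠ b → V e = U e) → V b = U b * expPt v → (∀ e, e ≠ b' → W e = U e) → W b' = U b' * expPt v' → (∀ e, e ≠ b' → Z e = V e) → Z b' = V b' * expPt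 v' → |(mfun Z - ((F.L : ℝ) ^ j / γ) * ∑ p, c' p * (1 - reTr (GaugeField.plaqHol Z p))) - (mfun V - ((F.L : ℝ) ^ j / γ) * ∑ p, c' p * (1 - reTr (GaugeField.plaqHol V p))) - (mfun W - ((F.L : ℝ) ^ j / γ) * ∑ p, c' p * (1 - reTr (GaugeField.plaqHol W p))) + (mfun U - ((F.L : ℝ) ^ j / γ) * ∑ p, c' p * (1 - reTr (GaugeField.plaqHol U p)))| ≤ k' b b' * (‖v‖ / (θBal F.L γ b₀ p₀ j / 4)) * (‖v'‖ / (θBal F.L γ b₀ p₀ j / 4))) := by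
  classical
  obtain ⟨pW, γF, hγF, hF⟩ := hF
  refine ⟨pW, min γF 1, lt_min hγF one_pos, ?_⟩
  intro F γ hγ hγ1 b₀ p₀ j₀ prm η rA Bρ hb₀ hp₀ hpW hadm hη0 hηs hηss hηt hrA
  have hγone : γ ≤ 1 := hγ1.trans (min_le_right _ _)
  obtain ⟨κ₀, hκ₀, hF⟩ := hF F γ hγ (hγ1.trans (min_le_left _ _)) b₀ p₀ j₀ prm η rA Bρ hb₀ hp₀ hpW hadm hη0 hηs hηss hηt hrA
  refine ⟨κ₀, hκ₀, ?_⟩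
  intro κ hκ hκle
  obtain ⟨rc, w₀, NT, NX, NL, CJ, NV1, NV2, NV3, NV4, δT, δX, δL, δV1, δV2, δV3, δV4, j₁, hrc, hw₀, hNT, hNX, hNL, hCJ,
    hδ0, hδTs, hδTss, hδTt, hδXs, hδXss, hδXt, hδLs, hδLss, hδLt, -, hj₁, hF⟩ := hF κ hκ hκle
  -- the multi-window cut's height (✓exists_height_multiWindowWeight)
  obtain ⟨jA, hMWA⟩ := exists_height_multiWindowWeight F γ b₀ p₀ hγ hγone hb₀
  -- LIN's package: θ := 1, r := rc/2, Ctr := max 1 (NT + 3NX + NL), w₀ := w₀, εd := 0, δ := δT + 3δX + δL, j₁ := max j₁ jA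
  have hT : ∀ i, Summable (fun k => δT (k + i)) := fun i => (summable_nat_add_iff i).mpr hδTs
  have hX : ∀ i, Summable (fun k => δX (k + i)) := fun i => (summable_nat_add_iff i).mpr hδXs
  have hL : ∀ i, Summable (fun k => δL (k + i)) := fun i => (summable_nat_add_iff i).mpr hδLs
  have htsum : ∀ i, (∑' k, (δT (k + i) + 3 * δX (k + i) + δL (k + i)))
      = (∑' k, δT (k + i)) + 3 * (∑' k, δX (k + i)) + ∑' k, δL (k + i) := by
    intro i
    rw [((hT i).add ((hX i).mul_left 3)).tsum_add (hL i), (hT i).tsum_add ((hX i).mul_left 3), tsum_mul_left]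
  refine ⟨1, rc / 2, max 1 (NT + 3 * NX + NL), w₀, fun _ => 0, fun n => δT n + 3 * δX n + δL n, max j₁ jA,
    one_pos, half_pos hrc, le_max_left _ _, hw₀, ?_, summable_zero, (hδTs.add (hδXs.mul_left 3)).add hδLs, ?_, ?_, hj₁.trans (le_max_left _ _), ?_⟩
  · intro n
    exact ⟨le_rfl, add_nonneg (add_nonneg (hδ0 n).1 (mul_nonneg (by norm_num : (0:ℝ) ≤ 3) (hδ0 n).2.1)) (hδ0 n).2.2⟩
  · have key : (fun i => ∑' k, (δT (k + i) + 3 * δX (k + i) + δL (k + i)))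
        = fun i => (∑' k, δT (k + i)) + 3 * (∑' k, δX (k + i)) + ∑' k, δL (k + i) := funext htsum
    rw [key]
    exact (hδTss.add (hδXss.mul_left 3)).add hδLss
  · have key : (fun j => (∑' k, (δT (k + j) + 3 * δX (k + j) + δL (k + j))) * ((1 + 2 * ((F.L : ℝ) ^ j / γ)
          * (Fintype.card (Plaq (F.P j) 0) : ℝ)) * (Fintype.card (PBond (F.P j) 0) : ℝ) ^ 2))
        = fun j => (∑' k, δT (k + j)) * ((1 + 2 * ((F.L : ℝ) ^ j / γ) * (Fintype.card (Plaq (F.P j) 0) : ℝ))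
            * (Fintype.card (PBond (F.P j) 0) : ℝ) ^ 2)
          + 3 * ((∑' k, δX (k + j)) * ((1 + 2 * ((F.L : ℝ) ^ j / γ) * (Fintype.card (Plaq (F.P j) 0) : ℝ))
            * (Fintype.card (PBond (F.P j) 0) : ℝ) ^ 2))
          + (∑' k, δL (k + j)) * ((1 + 2 * ((F.L : ℝ) ^ j / γ) * (Fintype.card (Plaq (F.P j) 0) : ℝ))
            * (Fintype.card (PBond (F.P j) 0) : ℝ) ^ 2) := by
      funext j; rw [htsum j]; ring
    rw [key]
    simpa using (hδTt.add (hδXt.const_mul 3)).add hδLt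
  · intro ν hG hCν K K' hKK' Ts T hTs hTK μ μ' ρ ρ' hanch hcut hcons hfin hwin w hw0 hwle hseed j hj hjTs σ hσM hσb hσf
      mfun hmc hmae
    have hj1 : j₁ ≤ j := (le_max_left _ _).trans hj
    have hjA : jA ≤ j := (le_max_right _ _).trans hj
    -- the stride's chart and clauses
    obtain ⟨Z, instZ, τ, Φ, J, S, π, hτ, hΦm, hJm, hSm, hS, hsec, hdis, hcont, hJle, hpos, hπ1, hπ2, hH, -⟩ :=
      hF ν hG hCν K K' hKK' Ts T hTs hTK μ μ' ρ ρ' hanch hcut hcons hfin hwin j hj1 hjTs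
    obtain ⟨k, hk0, hkrow, hksq⟩ := hseed
    obtain ⟨hJT, hL1, hL2⟩ := hH k w hw0 hwle hk0 hkrow hksq
    obtain ⟨k', hk'0, hk'row, hA⟩ := hJT 0 le_rfl zero_le_one
    obtain ⟨kX, hkX0, hkXrow, hkXcol, hLX⟩ := hL1 0 le_rfl zero_le_one
    obtain ⟨kL, hkL0, hkLrow, hL0⟩ := hL2 0 le_rfl zero_le_one
    -- the units
    have hLpos : (0 : ℝ) < (F.L : ℝ) := by exact_mod_cast (lt_trans zero_lt_one F.hL.2)
    have hθj : 0 < θBal F.L γ b₀ p₀ j := T3MinimiserStabilityReduction.θBal_pos F.hL.2.le hγ hγone hb₀ p₀ j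
    have hθT : 0 < θBal F.L γ b₀ p₀ Ts := T3MinimiserStabilityReduction.θBal_pos F.hL.2.le hγ hγone hb₀ p₀ Ts
    have hDj : 0 < ((F.L : ℝ) ^ j / γ) * θBal F.L γ b₀ p₀ j ^ 2 := mul_pos (div_pos (pow_pos hLpos j) hγ) (pow_pos hθj 2)
    have hDT : 0 < ((F.L : ℝ) ^ Ts / γ) * θBal F.L γ b₀ p₀ Ts ^ 2 := mul_pos (div_pos (pow_pos hLpos Ts) hγ) (pow_pos hθT 2)
    have hx0 : 0 ≤ w / (((F.L : ℝ) ^ Ts / γ) * θBal F.L γ b₀ p₀ Ts ^ 2) := div_nonneg hw0 hDT.le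
    -- STEP 2 (σ-version = chart fibre mean on the window): ✓SigmaVersionChartMean.sigmaVersion_eq_chartRatio + the `wgt₀` spelling
    have hTs₀ : j₀ ≤ Ts := by omega
    have hTsT : Ts ≤ T := hTs.le
    have hposT : ∀ U, PlaqSmall (θBal F.L γ b₀ p₀ Ts) U → 0 < ρ Ts U ∧ 0 < ρ' Ts U := fun U hU => (hwin Ts hTs₀ hTsT).1 U hU
    have hcT : ContinuousOn (ρ Ts) {U | PlaqSmall (θBal F.L γ b₀ p₀ Ts) U} := (hwin Ts hTs₀ hTsT).2.2.2.2.2.2.2.1.1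
    have hcT' : ContinuousOn (ρ' Ts) {U | PlaqSmall (θBal F.L γ b₀ p₀ Ts) U} := (hwin Ts hTs₀ hTsT).2.2.2.2.2.2.2.1.2
    have hmeasT : ∀ (f : GaugeField (F.P Ts) 0 ↥(Matrix.specialUnitaryGroup (Fin 2) ℂ) → ℝ),
        (∃ (K : ℕ) (hjK : Ts ≤ K),
        ∃ κ : ℝ, ∃ (bg : GaugeField (F.P K) (K - Ts) (Matrix.specialUnitaryGroup (Fin 2) ℂ) → GaugeField (F.P K) 0 (Matrix.specialUnitaryGroup (Fin 2) ℂ))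
          (nDom : ℕ) (supp : Fin nDom → Set (PBond (F.P K) 0)) (foot : Fin nDom → Finset (Site (F.P K) (K - Ts)))
          (len : Fin nDom → ℝ) (wt : Fin nDom → ℝ) (act : Fin nDom → GaugeField (F.P K) 0 (Matrix.specialUnitaryGroup (Fin 2) ℂ) → ℝ)
          (cst : ℝ) (lf : GaugeField (F.P K) (K - Ts) (Matrix.specialUnitaryGroup (Fin 2) ℂ) → ℝ),
          (∀ V, 0 ≤ readAtLevel F hjK (fun U => Real.exp κ * f U) V) ∧
          Measurable (readAtLevel F hjK (fun U => Real.exp κ * f U)) ∧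
          GaugeField.GaugeInvariant (readAtLevel F hjK (fun U => Real.exp κ * f U)) ∧
          (∀ V, PlaqSmall (prm Ts).δ V →
            IsBackground (fun i => BlockAveraging.blockAvg (P := F.P K) (j := i) ℰp) {U | PlaqSmall (prm Ts).δreg U} (K - Ts) V (bg V)) ∧
          (∀ X, (foot X).Nonempty) ∧ (∀ X b, b ∈ supp X → iterBlockOf (K - Ts) b.src ∈ foot X) ∧ (∀ X, 0 ≤ len X) ∧ (∀ X, 0 ≤ wt X) ∧
          (∀ X, ∀ y ∈ foot X, ∀ y' ∈ foot X, (Site.tdist y y' : ℝ) ≤ (prm Ts).M * (len X + 1)) ∧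
          (∀ X (U U' : GaugeField (F.P K) 0 (Matrix.specialUnitaryGroup (Fin 2) ℂ)), (∀ b ∈ supp X, U b = U' b) → act X U = act X U') ∧
          (∀ X, GaugeField.GaugeInvariant (act X)) ∧
          (∀ X V, PlaqSmall (prm Ts).δ V → PlaqSmall ((prm Ts).δ * ((F.L : ℝ)⁻¹) ^ (2 * (K - Ts))) (bg V) →
            |act X (bg V)| ≤ wt X * Real.exp (-((prm Ts).κ * len X))) ∧
          (∀ y : Site (F.P K) (K - Ts), ∑ X ∈ Finset.univ.filter (fun X => y ∈ foot X), wt X * Real.exp (-((prm Ts).κ * len X)) ≤ (prm Ts).Ccov) ∧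
          |cst| ≤ (prm Ts).cE * Fintype.card (Site (F.P K) (K - Ts)) ∧
          (∀ V, PlaqSmall (prm Ts).δ V → PlaqSmall ((prm Ts).δ * ((F.L : ℝ)⁻¹) ^ (2 * (K - Ts))) (bg V) →
            Real.exp (-((prm Ts).β * wilsonAction4 (bg V)) + (∑ X, act X (bg V)) + cst - (prm Ts).slack) ≤ readAtLevel F hjK (fun U => Real.exp κ * f U) V) ∧
          (∀ V, PlaqSmall (prm Ts).δ V → PlaqSmall ((prm Ts).δ * ((F.L : ℝ)⁻¹) ^ (2 * (K - Ts))) (bg V) →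
            readAtLevel F hjK (fun U => Real.exp κ * f U) V ≤ Real.exp (-((prm Ts).β * wilsonAction4 (bg V)) + (∑ X, act X (bg V)) + cst + (prm Ts).slack) + lf V) ∧
          (∀ V, 0 ≤ lf V) ∧ (∀ V, lf V ≤ Real.exp (-(prm Ts).cLF) * Real.exp ((prm Ts).c5 * Fintype.card (Site (F.P K) (K - Ts)))) ∧
          (∀ V (S : Finset (Plaq (F.P K) (K - Ts))), (∀ p ∈ S, (prm Ts).δL ≤ dist1 (GaugeField.plaqHol V p)) →
            readAtLevel F hjK (fun U => Real.exp κ * f U) V ≤ Real.exp (-((prm Ts).cLF * S.card)) * Real.exp ((prm Ts).c5 * Fintype.card (Site (F.P K) (K - Ts))))) → Measurable f := by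
      intro f ⟨K, hjK, κ', _bg, _nDom, _supp, _foot, _len, _wt, _act, _cst, _lf, _h0, hκ', _⟩
      have hm1 : Measurable (fun U => Real.exp κ' * f U) := measurable_of_readAtLevel F hjK hκ'
      have hm2 : f = fun U => (Real.exp κ')⁻¹ * (Real.exp κ' * f U) := by
        funext U; rw [← mul_assoc, inv_mul_cancel₀ (Real.exp_pos κ').ne', one_mul]
      rw [hm2]; exact hm1.const_mul _
    have hρm : Measurable (ρ Ts) := hmeasT _ (hwin Ts hTs₀ hTsT).2.2.2.1
    have hρ'm : Measurable (ρ' Ts) := hmeasT _ (hwin Ts hTs₀ hTsT).2.2.2.2.1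
    obtain ⟨hχc, hχ0, hχsupp, hχpos⟩ := hMWA j hjA Ts hjTs
    haveI : BorelSpace (GaugeField (F.P Ts) 0 ↥(Matrix.specialUnitaryGroup (Fin 2) ℂ)) :=
      Literature.MathematicalPhysics.QuantumFieldTheory.Balaban1983to89.T3OrbitAverage.instBorelSpaceGaugeField
    have hχm := hχc.measurable
    haveI := hσM
    haveI := hτ
    have hmae' : ∀ᵐ V ∂(fieldMeasure (F.P j) 0 ↥(Matrix.specialUnitaryGroup (Fin 2) ℂ)), PlaqSmall (θBal F.L γ b₀ p₀ j) V →
        mfun V = (∫ U, (fun U : GaugeField (F.P Ts) 0 ↥(Matrix.specialUnitaryGroup (Fin 2) ℂ) => ∏ i ∈ Finset.range (Ts - j), (if h : j + 1 + i ≤ Ts then (∏ p : Plaq (F.P (j + 1 + i)) 0, max 0 (min 1 ((24 / 25 * θBal F.L γ b₀ p₀ (j + 1 + i) - dist1 (GaugeField.plaqHol (descendTo F ℰp (j + 1 + i) Ts h U) p)) / ((24 / 25 - 1 / 2) * θBal F.L γ b₀ p₀ (j + 1 + i))))) else 1)) U * (Real.log (ρ Ts U) - Real.log (ρ' Ts U))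 * ρ' Ts U ∂(σ V)) / (∫ U, (fun U : GaugeField (F.P Ts) 0 ↥(Matrix.specialUnitaryGroup (Fin 2) ℂ) => ∏ i ∈ Finset.range (Ts - j), (if h : j + 1 + i ≤ Ts then (∏ p : Plaq (F.P (j + 1 + i)) 0, max 0 (min 1 ((24 / 25 * θBal F.L γ b₀ p₀ (j + 1 + i) - dist1 (GaugeField.plaqHol (descendTo F ℰp (j + 1 + i) Ts h U) p)) / ((24 / 25 - 1 / 2) * θBal F.L γ b₀ p₀ (j + 1 + i))))) else 1)) U * ρ' Ts U ∂(σ V)) :=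
      hmae.mono fun V h hV => (h hV).2
    have hSV := Summit.QuantumFields.YangMills.Theorems.OrganTangentSigmaVersionChartMean.sigmaVersion_eq_chartRatio F γ b₀ p₀ j Ts hjTs
      (ρ Ts) (ρ' Ts) hρm hρ'm hcT hcT' hposT hθT (fun U : GaugeField (F.P Ts) 0 ↥(Matrix.specialUnitaryGroup (Fin 2) ℂ) => ∏ i ∈ Finset.range (Ts - j), (if h : j + 1 + i ≤ Ts then (∏ p : Plaq (F.P (j + 1 + i)) 0, max 0 (min 1 ((24 / 25 * θBal F.L γ b₀ p₀ (j + 1 + i) - dist1 (GaugeField.plaqHol (descendTo F ℰp (j + 1 + i) Ts h U) p)) / ((24 / 25 - 1 / 2) * θBal F.L γ b₀ p₀ (j + 1 + i))))) else 1)) hχc hχm hχ0 hχsupp hχpos σ hσb hσf mfun hmc hmae' τ Φ J S hΦm hJm hSm hS hdis hcont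
      CJ hJle hpos
    have hrep : ∀ V, PlaqSmall (θBal F.L γ b₀ p₀ j / 4) V →
        mfun V = ∫ z, (Real.log (ρ Ts (Φ (V, z))) - Real.log (ρ' Ts (Φ (V, z)))) * (wgt F γ b₀ p₀ j Ts ρ ρ' τ Φ J 0) V z ∂τ := by
      intro V hV4
      have hV : PlaqSmall (θBal F.L γ b₀ p₀ j) V := fun p => (hV4 p).trans_le (by linarith [hθj.le])
      obtain ⟨hM, hEq⟩ := hSV V hV
      rw [hEq]
      have hnum : ∀ z, (fun U : GaugeField (F.P Ts) 0 ↥(Matrix.specialUnitaryGroup (Fin 2) ℂ) => ∏ i ∈ Finset.range (Ts - j), (if h : j + 1 + i ≤ Ts then (∏ p : Plaq (F.P (j + 1 + i)) 0, max 0 (min 1 ((24 / 25 * θBal F.L γ b₀ p₀ (j + 1 + i) - dist1 (GaugeField.plaqHol (descendTo F ℰp (j + 1 + i) Ts h U) p)) / ((24 / 25 - 1 / 2) * θBal F.L γ b₀ p₀ (j + 1 + i))))) else 1)) (Φ (V, z)) * (Real.log (ρ Ts (Φ (V, z))) - Real.log (ρ' Ts (Φ (V, z)))) * ρ' Ts (Φ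 (V, z)) * (J (V, z) : ℝ)
          = (Real.log (ρ Ts (Φ (V, z))) - Real.log (ρ' Ts (Φ (V, z)))) * ((fun U : GaugeField (F.P Ts) 0 ↥(Matrix.specialUnitaryGroup (Fin 2) ℂ) => ∏ i ∈ Finset.range (Ts - j), (if h : j + 1 + i ≤ Ts then (∏ p : Plaq (F.P (j + 1 + i)) 0, max 0 (min 1 ((24 / 25 * θBal F.L γ b₀ p₀ (j + 1 + i) - dist1 (GaugeField.plaqHol (descendTo F ℰp (j + 1 + i) Ts h U) p)) / ((24 / 25 - 1 / 2) * θBal F.L γ b₀ p₀ (j + 1 + i))))) else 1)) (Φ (V, z)) * ρ' Ts (Φ (V, z)) * (J (V, z) : ℝ)) := fun z => by ring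
      simp_rw [hnum]
      rw [← integral_div]
      refine integral_congr_ae (Eventually.of_forall fun z => ?_)
      simp only [wgt, wNum, mwCut, Real.rpow_eq_pow, Real.rpow_zero, sub_zero, Real.rpow_one, one_mul, mul_div_assoc]
    -- the witnesses: c′ := 0, a′ := 0, k′_LIN := k′ + kX + 2·kXᵀ + kL
    refine ⟨fun _ => 0, 0,
      (NT + 3 * NX + NL) * ((((F.L : ℝ) ^ j / γ) * θBal F.L γ b₀ p₀ j ^ 2) / (((F.L : ℝ) ^ Ts / γ) * θBal F.L γ b₀ p₀ Ts ^ 2)) * w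
        + (δT j + 3 * δX j + δL j) * (((F.L : ℝ) ^ j / γ) * θBal F.L γ b₀ p₀ j ^ 2),
      le_rfl, ?_, ?_, fun p => by simp, fun B B' => k' B B' + kX B B' + 2 * kX B' B + kL B B', ?_, ?_, ?_⟩
    · -- 0 ≤ w′
      have h1 : 0 ≤ NT + 3 * NX + NL := by positivity
      have h2 : 0 ≤ δT j + 3 * δX j + δL j := by
        obtain ⟨a1, a2, a3⟩ := hδ0 j
        exact add_nonneg (add_nonneg a1 (mul_nonneg (by norm_num) a2)) a3
      exact add_nonneg (mul_nonneg (mul_nonneg h1 (div_nonneg hDj.le hDT.le)) hw0) (mul_nonneg h2 hDj.le)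
    · -- the budget line
      have key : ((NT + 3 * NX + NL) * ((((F.L : ℝ) ^ j / γ) * θBal F.L γ b₀ p₀ j ^ 2) / (((F.L : ℝ) ^ Ts / γ) * θBal F.L γ b₀ p₀ Ts ^ 2)) * w
          + (δT j + 3 * δX j + δL j) * (((F.L : ℝ) ^ j / γ) * θBal F.L γ b₀ p₀ j ^ 2)) / (((F.L : ℝ) ^ j / γ) * θBal F.L γ b₀ p₀ j ^ 2)
          = (NT + 3 * NX + NL) * (w / (((F.L : ℝ) ^ Ts / γ) * θBal F.L γ b₀ p₀ Ts ^ 2)) + (δT j + 3 * δX j + δL j) := by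
        field_simp
      rw [key, zero_add, one_mul, add_zero]
      exact add_le_add (mul_le_mul_of_nonneg_right (le_max_right _ _) hx0) le_rfl
    · intro B B'
      exact add_nonneg (add_nonneg (add_nonneg (hk'0 B B') (hkX0 B B')) (mul_nonneg two_pos.le (hkX0 B' B))) (hkL0 B B')
    · -- row mass of k′_LIN
      intro B
      have hcol : ∑ B', kX B' B * Real.exp (κ * (B.src.tdist B'.src : ℝ)) ≤ NX * ((((F.L : ℝ) ^ j / γ) * θBal F.L γ b₀ p₀ j ^ 2) /
          (((F.L : ℝ) ^ Ts / γ) * θBal F.L γ b₀ p₀ Ts ^ 2)) * w + δX j * (((F.L : ℝ) ^ j / γ) * θBal F.L γ b₀ p₀ j ^ 2) := by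
        have h := hkXcol B
        refine le_of_eq_of_le (Finset.sum_congr rfl fun B' _ => ?_) h
        rw [tdist_comm']
      have hsplit : ∑ B', (k' B B' + kX B B' + 2 * kX B' B + kL B B') * Real.exp (κ * (B.src.tdist B'.src : ℝ))
          = (∑ B', k' B B' * Real.exp (κ * (B.src.tdist B'.src : ℝ))) + (∑ B', kX B B' * Real.exp (κ * (B.src.tdist B'.src : ℝ)))
            + 2 * (∑ B', kX B' B * Real.exp (κ * (B.src.tdist B'.src : ℝ))) + (∑ B', kL B B' * Real.exp (κ * (B.src.tdist B'.src : ℝ))) := by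
        rw [Finset.mul_sum, ← Finset.sum_add_distrib, ← Finset.sum_add_distrib, ← Finset.sum_add_distrib]
        exact Finset.sum_congr rfl fun B' _ => by ring
      rw [hsplit]
      calc _ ≤ _ := add_le_add (add_le_add (add_le_add (hk'row B) (hkXrow B)) (mul_le_mul_of_nonneg_left hcol two_pos.le)) (hkLrow B)
        _ = _ := by ring
    · -- the square clause
      intro b b' v v' U V W Y hv hv' hU hV hW hY hVU hVb hWU hWb' hYV hYb'
      simp only [zero_mul, Finset.sum_const_zero, mul_zero, sub_zero]
      have hθ4 : 0 < θBal F.L γ b₀ p₀ j / 4 := by positivity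
      have hvc : ‖v‖ ≤ rc * (θBal F.L γ b₀ p₀ j / 4) := hv.trans (mul_le_mul_of_nonneg_right (half_le_self hrc.le) hθ4.le)
      have hvc' : ‖v'‖ ≤ rc * (θBal F.L γ b₀ p₀ j / 4) := hv'.trans (mul_le_mul_of_nonneg_right (half_le_self hrc.le) hθ4.le)
      -- the fourth corner's law edge
      obtain ⟨m, hm, hYW, hYbm⟩ := fourthCorner_lawEdge U V W Y b b' v v' hVU hVb hWU hWb' hYV hYb'
      have hs3 : Real.sqrt 3 ≤ 2 := by
        rw [show (2 : ℝ) = Real.sqrt 4 by rw [show (4 : ℝ) = 2 ^ 2 by norm_num, Real.sqrt_sq (by norm_num : (0:ℝ) ≤ 2)]]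
        exact Real.sqrt_le_sqrt (by norm_num)
      have hm2 : ‖m‖ ≤ 2 * ‖v‖ := hm.trans (mul_le_mul_of_nonneg_right hs3 (norm_nonneg v))
      have hmc : ‖m‖ ≤ rc * (θBal F.L γ b₀ p₀ j / 4) := by
        refine hm2.trans ?_
        rw [show rc * (θBal F.L γ b₀ p₀ j / 4) = 2 * (rc / 2 * (θBal F.L γ b₀ p₀ j / 4)) by ring]
        exact mul_le_mul_of_nonneg_left hv two_pos.le
      -- abbreviations for the nine basic integrals
      rw [hrep U hU, hrep V hV, hrep W hW, hrep Y hY]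
      -- the four brackets
      obtain ⟨iUY, iVY, iWY, iYY, hIA⟩ := hA b b' v v' U V W Y hvc hvc' hU hV hW hY hVU hVb hWU hWb' hYV hYb'
      obtain ⟨iUV, iVV, iUY', iVY', hI1⟩ := hLX b b' v v' U V Y hvc hvc' hU hV hY hVU hVb hYV hYb'
      obtain ⟨iUW, iWW, iUY'', iWY', hI2⟩ := hLX b' b v' m U W Y hvc' hmc hU hW hY hWU hWb' hYW hYbm
      obtain ⟨iUU, iUV', iUW', iUY''', hI0⟩ := hL0 b b' v v' U V W Y hvc hvc' hU hV hW hY hVU hVb hWU hWb' hYV hYb'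
      -- bracket A as four basic integrals
      have hAeq : ∫ z, ((Real.log (ρ Ts (Φ (Y, z))) - Real.log (ρ' Ts (Φ (Y, z)))) - (Real.log (ρ Ts (Φ (V, z))) - Real.log (ρ' Ts (Φ (V, z))))
            - (Real.log (ρ Ts (Φ (W, z))) - Real.log (ρ' Ts (Φ (W, z)))) + (Real.log (ρ Ts (Φ (U, z))) - Real.log (ρ' Ts (Φ (U, z)))))
            * (wgt F γ b₀ p₀ j Ts ρ ρ' τ Φ J 0) Y z ∂τ
          = (∫ z, (Real.log (ρ Ts (Φ (Y, z))) - Real.log (ρ' Ts (Φ (Y, z)))) * (wgt F γ b₀ p₀ j Ts ρ ρ' τ Φ J 0) Y z ∂τ)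
            - (∫ z, (Real.log (ρ Ts (Φ (V, z))) - Real.log (ρ' Ts (Φ (V, z)))) * (wgt F γ b₀ p₀ j Ts ρ ρ' τ Φ J 0) Y z ∂τ)
            - (∫ z, (Real.log (ρ Ts (Φ (W, z))) - Real.log (ρ' Ts (Φ (W, z)))) * (wgt F γ b₀ p₀ j Ts ρ ρ' τ Φ J 0) Y z ∂τ)
            + (∫ z, (Real.log (ρ Ts (Φ (U, z))) - Real.log (ρ' Ts (Φ (U, z)))) * (wgt F γ b₀ p₀ j Ts ρ ρ' τ Φ J 0) Y z ∂τ) :=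
        integral_comb4_mul τ (fun z => (Real.log (ρ Ts (Φ (Y, z))) - Real.log (ρ' Ts (Φ (Y, z))))) (fun z => (Real.log (ρ Ts (Φ (V, z))) - Real.log (ρ' Ts (Φ (V, z))))) (fun z => (Real.log (ρ Ts (Φ (W, z))) - Real.log (ρ' Ts (Φ (W, z))))) (fun z => (Real.log (ρ Ts (Φ (U, z))) - Real.log (ρ' Ts (Φ (U, z)))))
          (fun z => (wgt F γ b₀ p₀ j Ts ρ ρ' τ Φ J 0) Y z) iYY iVY iWY iUY
      rw [hAeq] at hIA
      rw [rebracket (∫ z, (Real.log (ρ Ts (Φ (Y, z))) - Real.log (ρ' Ts (Φ (Y, z)))) * (wgt F γ b₀ p₀ j Ts ρ ρ' τ Φ J 0) Y z ∂τ) (∫ z, (Real.log (ρ Ts (Φ (V, z))) - Real.log (ρ' Ts (Φ (V, z)))) * (wgt F γ b₀ p₀ j Ts ρ ρ' τ Φ J 0) V z ∂τ) (∫ z, (Real.log (ρ Ts (Φ (W, z))) - Real.log (ρ' Ts (Φ (W, z)))) * (wgt F γ b₀ p₀ j Ts ρ ρ' τ Φ J 0) W z ∂τ) (∫ z, (Real.log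 (ρ Ts (Φ (U, z))) - Real.log (ρ' Ts (Φ (U, z)))) * (wgt F γ b₀ p₀ j Ts ρ ρ' τ Φ J 0) U z ∂τ) (∫ z, (Real.log (ρ Ts (Φ (V, z))) - Real.log (ρ' Ts (Φ (V, z)))) * (wgt F γ b₀ p₀ j Ts ρ ρ' τ Φ J 0) Y z ∂τ) (∫ z, (Real.log (ρ Ts (Φ (W, z))) - Real.log (ρ' Ts (Φ (W, z)))) * (wgt F γ b₀ p₀ j Ts ρ ρ' τ Φ J 0) Y z ∂τ) (∫ z, (Real.log (ρ Ts (Φ (U, z))) - Real.log (ρ' Ts (Φ (U, z)))) * (wgt F γ b₀ p₀ j Ts ρ ρ' τ Φ J 0) Y z ∂τ) (∫ z, (Real.log (ρ Ts (Φ (U, z))) - Real.log (ρ' Ts (Φ (U, z)))) * (wgt F γ b₀ p₀ j Ts ρ ρ' τ Φ J 0) V z ∂τ) (∫ z, (Real.log (ρ Ts (Φ (U, z))) - Real.log (ρ' Ts (Φ (U, z)))) * (wgt F γ b₀ p₀ j Ts ρ ρ' τ Φ J 0) W z ∂τ)]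
      have hs : 0 ≤ ‖v‖ / (θBal F.L γ b₀ p₀ j / 4) := div_nonneg (norm_nonneg _) hθ4.le
      have hs' : 0 ≤ ‖v'‖ / (θBal F.L γ b₀ p₀ j / 4) := div_nonneg (norm_nonneg _) hθ4.le
      have hI2' : |((∫ z, (Real.log (ρ Ts (Φ (W, z))) - Real.log (ρ' Ts (Φ (W, z)))) * (wgt F γ b₀ p₀ j Ts ρ ρ' τ Φ J 0) Y z ∂τ)
            - (∫ z, (Real.log (ρ Ts (Φ (U, z))) - Real.log (ρ' Ts (Φ (U, z)))) * (wgt F γ b₀ p₀ j Ts ρ ρ' τ Φ J 0) Y z ∂τ))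
            - ((∫ z, (Real.log (ρ Ts (Φ (W, z))) - Real.log (ρ' Ts (Φ (W, z)))) * (wgt F γ b₀ p₀ j Ts ρ ρ' τ Φ J 0) W z ∂τ)
            - (∫ z, (Real.log (ρ Ts (Φ (U, z))) - Real.log (ρ' Ts (Φ (U, z)))) * (wgt F γ b₀ p₀ j Ts ρ ρ' τ Φ J 0) W z ∂τ))|
          ≤ 2 * kX b' b * (‖v‖ / (θBal F.L γ b₀ p₀ j / 4)) * (‖v'‖ / (θBal F.L γ b₀ p₀ j / 4)) := by
        refine hI2.trans ?_
        have hmv : ‖m‖ / (θBal F.L γ b₀ p₀ j / 4) ≤ 2 * (‖v‖ / (θBal F.L γ b₀ p₀ j / 4)) := by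
          rw [← mul_div_assoc]; exact div_le_div_of_nonneg_right hm2 hθ4.le
        have hk := hkX0 b' b
        calc kX b' b * (‖v'‖ / (θBal F.L γ b₀ p₀ j / 4)) * (‖m‖ / (θBal F.L γ b₀ p₀ j / 4))
            ≤ kX b' b * (‖v'‖ / (θBal F.L γ b₀ p₀ j / 4)) * (2 * (‖v‖ / (θBal F.L γ b₀ p₀ j / 4))) :=
              mul_le_mul_of_nonneg_left hmv (mul_nonneg hk hs')
          _ = 2 * kX b' b * (‖v‖ / (θBal F.L γ b₀ p₀ j / 4)) * (‖v'‖ / (θBal F.L γ b₀ p₀ j / 4)) := by ring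
      refine (abs_add_four _ _ _ _).trans ?_
      refine (add_le_add (add_le_add (add_le_add hIA hI1) hI2') hI0).trans (le_of_eq ?_)
      ring


end Summit.QuantumFields.YangMills.Theorems.OrganTangentTangentHOfSpreadFibreLawSqE

end
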